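import Summits.HubbardSuperconductivity.HubbardSuperconductivity.Theorems.SoloBlindTrialSubspaceTransfer
import Summits.HubbardSuperconductivity.HubbardSuperconductivity.Theorems.SoloBlindTrialSubspaceGap
import HarnessLib

/-!
# The variational blueprint is equivalent to the summit

Corollary of `SoloBlindTrialSubspaceTransfer` (`hubbardSuperconductivity_of_trialSubspaces`, the
blueprint is sufficient) and `SoloBlindTrialSubspaceGap`
(`trialSubspaces_of_hubbardSuperconductivity`, it is necessary: take the ground eigenspace itself,
`η = 0`, and the finite-volume gap above the ground multiplet): `HubbardSuperconductivity` holds IFF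
for some `U > 0`, `δ ∈ (0,1/2)`, `c > 0`, `L₀` and every even side `L ≥ L₀` there are a trial
subspace `T` of the doped `S^z = 0` sector and `η`, `γ > 0` with `1600η ≤ cγ` such that: d-wave
ORDER `cL⁴‖φ‖²` on `T`, variational ENERGY `≤ (E₀ + η)‖φ‖²` on `T`, GAP `γ` above the ground
multiplet inside the sector, and COVER (no sector ground state orthogonal to `T`). The whole content
of a proof is in the ratio `η_L/γ_L ≤ c/1600`, uniformly in `L` (obstruction report §5.5).
-/

namespace Summit.HubbardSuperconductivity.HubbardSuperconductivity.Theorems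

open Matrix Finset Literature.MathematicalPhysics.QuantumLattice
  Literature.MathematicalPhysics.QuantumFieldTheory GaugeTwist WithLp
open scoped ComplexConjugate ComplexOrder

/-- **`HubbardSuperconductivity` ⟺ the variational blueprint** (ORDER on a trial subspace,
ENERGY within `η` of the sector ground energy, GAP `γ` above the ground multiplet, `1600η ≤ cγ`,
COVER). [this work] -/
theorem hubbardSuperconductivity_iff_trialSubspaces :
    HubbardSuperconductivity ↔
      ∃ U : ℝ, 0 < U ∧ ∃ δ ∈ Set.Ioo (0 : ℝ) (1 / 2), ∃ c : ℝ, 0 < c ∧ ∃ L₀ : ℕ,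
        ∀ n : ℕ, Even (n + 1) → L₀ ≤ n + 1 →
          ∃ (T : Submodule ℂ (Fock (Orb (FermionTorus 2 (n + 1))))) (η γ : ℝ), 0 < γ ∧
            1600 * η ≤ c * γ ∧
            T ≤ szSector (Λ := FermionTorus 2 (n + 1))
              (2 * ⌊(1 - δ) * ((n + 1 : ℕ) : ℝ) ^ 2 / 2⌋₊) 0 ∧
            (∀ φ ∈ T, c * ((n + 1 : ℕ) : ℝ) ^ 4 * (star φ ⬝ᵥ φ).re ≤ (expect
              ((pairField dWaveFormFactor (n + 1))ᴴ * pairField dWaveFormFactor (n + 1)) φ).re) ∧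
            (∀ φ ∈ T, (star φ ⬝ᵥ (hubbardTorus 2 (n + 1) 1 U *ᵥ φ)).re -
                (hubbardTorus 2 (n + 1) 1 U).minEnergyOn
                  (szSector (2 * ⌊(1 - δ) * ((n + 1 : ℕ) : ℝ) ^ 2 / 2⌋₊) 0) * (star φ ⬝ᵥ φ).re ≤
              η * (star φ ⬝ᵥ φ).re) ∧
            (∀ w ∈ szSector (Λ := FermionTorus 2 (n + 1))
                (2 * ⌊(1 - δ) * ((n + 1 : ℕ) : ℝ) ^ 2 / 2⌋₊) 0,
              (∀ ψ, IsGroundStateInSector (hubbardTorus 2 (n + 1) 1 U)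
                (2 * ⌊(1 - δ) * ((n + 1 : ℕ) : ℝ) ^ 2 / 2⌋₊) 0 ψ → star ψ ⬝ᵥ w = 0) →
              γ * (star w ⬝ᵥ w).re ≤ (star w ⬝ᵥ (hubbardTorus 2 (n + 1) 1 U *ᵥ w)).re -
                (hubbardTorus 2 (n + 1) 1 U).minEnergyOn
                  (szSector (2 * ⌊(1 - δ) * ((n + 1 : ℕ) : ℝ) ^ 2 / 2⌋₊) 0) * (star w ⬝ᵥ w).re) ∧
            (∀ ψ, IsGroundStateInSector (hubbardTorus 2 (n + 1) 1 U)
                (2 * ⌊(1 - δ) * ((n + 1 : ℕ) : ℝ) ^ 2 / 2⌋₊) 0 ψ → ∃ φ ∈ T, star φ ⬝ᵥ ψ ≠ 0) :=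
  ⟨trialSubspaces_of_hubbardSuperconductivity, hubbardSuperconductivity_of_trialSubspaces⟩

end Summit.HubbardSuperconductivity.HubbardSuperconductivity.Theorems
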